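import Summits.QuantumFields.YangMills.Theorems.BalabanUVNodesN18TwoBlockLoopStokes
import Summits.QuantumFields.YangMills.Theorems.BalabanUVNodesN18TransportedPairGcValuedInterior
import Summits.QuantumFields.YangMills.Theorems.BalabanUVNodesN18LocalGaugeTransportCube
import HarnessLib

/-!
# BalabanUVNodes ∕ node N18 = NE5 — closure-ledger item (iii): THE TRANSPORTED PAIR IS `SL(N, ℂ)`-VALUED AT EVERY FRAME BOND, FROM RUN B's CONDITIONS (i)–(iii) ALONE —
# the letter `hUGc` of the (T3) letter form WITHOUT the (1.12)-cube proviso of FILE 12 (interior, face-crossing and boundary bonds alike)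
# (Track A, DAG node N18 = `T4OutputRate.NE5` :211; cluster K4 «SpineRates», item K3⁷ `SpineGivenEndpointR13SepCoPH`; seat pub-ymgap-dag-n18-w3 g4)

HONEST FRAMING.  Count-neutral kernel bookkeeping (`--supports stmt-QuantumFields-20544 --as helper`): FILE 12 (`…N18TransportedPairGcValuedInterior`, p609583) with
its loop input taken from (1.11) through this seat's two-block box Stokes (`…N18TwoBlockLoopStokes`, ★★★ `YMDAG.N18.BoxStokes.norm_loopVarU_sub_one_le_of_plaq_twoBlock`)
instead of from the (1.12) local gauge of ONE cube (FILE 11) — so the two blocks of the coarse bond need only lie inside run B's REGION (its bonds AND its plaquettes),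
not inside one (1.12) cube: the located point [DAGN18W3-G3-LOCATED-1] is closed for the `hUGc` letter.  The smallness thresholds are displayed numerics.  Nothing of
Bałaban's renormalization group is asserted; NE5 NOT PRINTED ∕ NOT proved; N18 NOT discharged; nothing about the continuum ∕ OS ∕ mass gap ∕ Clay.

WHAT.
* ★★★ `avgUnits_mem_suModel_Gc_of_satisfiesI_III_of_plaqs` — for a pair `Φ` satisfying (i)–(iii) (`suModel N`, any frame `FB`, constants `cB`, radii `α₀, α₁, γ₀`) and a
  coarse bond `c` whose two-block bonds are bonds of the region and whose two-block plaquettes (all four corners in `B(c₋) ∪ B(c₊)`) are plaquettes of the region: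
  `Ū(Φ.𝐔)(c) ∈ SL(N, ℂ)`, under `0 ≤ ξ`, `0 ≤ α₀`, `0 ≤ α₁`, `ξα₁ ≤ 1∕4`, `r + ((1+2ε)^ℓ − 1) ≤ 1∕3`, `N·(r + ((1+2ε)^ℓ − 1)) < π` with `r = (ℓ²∕2)·α₀ξ²`, `ε = 2ξα₁`,
  `ℓ = (d+2)L` (the loops of the `SU(N)`-valued factor `U` of `𝐔 = (exp iξA′)U` are within `r` of `1` by the box Stokes from (1.11); then FILE 10's
  `avgUnits_mem_suModel_Gc_of_factors` on the cut-off fields, as in FILE 12).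
* ★★★ `TΦOfRecord_U_mem_suModel_Gc_of_satisfiesI_III_of_plaqs` — the same read through W1-18's transport of record at a run-A bond `b` (`c = bondShift b`).
* `twoBlocks_subset_plaqs_preimage` — the plaquette twin of this seat's g2 `YMDAG.N18.AvgPotential.twoBlocks_subset_bonds_preimage`: a fine plaquette with its four
  corners' blocks over `{y, y + e_μ} ⊂ Z` is a plaquette of run B's region over `Z` (`regionOfSet (bmap ⁻¹' Z)`).
* ★★★★ `TΦOfRecord_U_mem_suModel_Gc_of_satisfiesI_III_frameBond` — AT THE FRAMES OF RECORD: for every bond `b` of run A's region `regionOfSet (domSites Y)` (both ends in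
  `Y`'s sites — interior, cube-face-crossing or boundary alike) and every `Φ` satisfying (i)–(iii) of run B on `frameI Rz M (j+1) (domSites π(j, Y))`,
  `(TΦOfRecord F N k Φ).U b ∈ SL(N, ℂ)` — the `hUGc` conjunct of FILE 7's `hletters` (`…N18TransportLettersOfRecord`) at the model of record (`(Sg k).𝓜 = suModel N` by
  `rfl` at the settings of record), from run B's (i)–(iii) + the displayed numerics ONLY (19c `domSites_pairOfRecord_eq_preimage`: `domSites π(j,Y) = bmap ⁻¹' domSites Y`).

0 `def`, 0 `sorry`.  References: T. Bałaban, CMP **109** (1987) 249–301 [Balaban1987RG1] ((0.4)–(0.5) p.253, (0.24)–(0.25) p.257, (1.10)–(1.14) p.262); CMP **98**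
(1985) 17–51 [Balaban1985Averaging] ((19)–(20) p.21, pp.24–25).
-/

noncomputable section

open scoped BigOperators Matrix.Norms.L2Operator

namespace YMDAG.N18.TransportOfRecord

open Literature.MathematicalPhysics.QuantumFieldTheory.Balaban1983to89
open Literature.MathematicalPhysics.QuantumFieldTheory.Balaban1983to89.T4Continuum
open Literature.MathematicalPhysics.QuantumFieldTheory.Balaban1983to89.T4LevelShift
open Literature.MathematicalPhysics.QuantumFieldTheory.Balaban1983to89.BlockAveraging
open Literature.MathematicalPhysics.QuantumFieldTheory.Balaban1983to89.B12RegularSpaces111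
open Literature.MathematicalPhysics.QuantumFieldTheory.Balaban1983to89.B12RegularSpaces111SpecialUnitary (suModel mem_suModel_Gc suModel_norm_le)
open Literature.MathematicalPhysics.QuantumFieldTheory.Balaban1983to89.B7Prop1Explicit (U1 mem_U1)
open Literature.MathematicalPhysics.QuantumFieldTheory.Balaban1983to89.Node00 (MatA)
open Literature.MathematicalPhysics.QuantumFieldTheory.Balaban1983to89.Node00.W1
open Literature.MathematicalPhysics.QuantumFieldTheory.Balaban1983to89.Node00.Sect2 (regionOfSet domSys domSites frameI)
open Summit.QuantumFields.YangMills.Theorems.Prop8Chart (emlAvgU_congr₂ holT_loopWord_congr₂)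
open YMDAG.N18.BoxStokes (norm_loopVarU_sub_one_le_of_plaq_twoBlock)

/-! ## §1 `Ū(𝐔)(c) ∈ SL(N, ℂ)` from (i)–(iii) when the two blocks of `c` lie in the region -/

section Region

variable {P : Params} {N : ℕ} [NeZero N]

/-- ★★★ **`Ū(𝐔)(c) ∈ SL(N, ℂ)` FROM (i)–(iii), THE TWO BLOCKS INSIDE THE REGION**.  From `SatisfiesI_III (suModel N) FB cB α₀ α₁ γ₀ Φ`: `𝐔 = (exp iξA′)·U` everywhere,
`𝐔` `SL`-valued and `|A′| < α₁` on the region's bonds, `U` `SU(N)`-valued there with `|∂U − 1| < α₀ξ²` on the region's plaquettes (1.11); if the fine bonds with both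
ends in the two blocks of `c`, and the fine plaquettes with all four corners there, belong to the region, then the loops of `U` at `c` are within `r = (ℓ²∕2)·α₀ξ²` of `1`
(`YMDAG.N18.BoxStokes.norm_loopVarU_sub_one_le_of_plaq_twoBlock`, `SU(N) ⊂ U1`), the chart factors within `ε = 2ξα₁`, and FILE 10's `avgUnits_mem_suModel_Gc_of_factors`
applies to the fields CUT OFF to `1` off the two blocks (same `Ū(c)`, UST `emlAvgU_congr₂`).  No (1.12) cube is used. [cite: Balaban1987RG1, before (0.5) p.253, (1.10)-(1.14) p.262] -/
theorem avgUnits_mem_suModel_Gc_of_satisfiesI_III_of_plaqs (hj : 0 + 1 ≤ P.m + P.K) {FB : Frame P 0 (MatA N)} {cB : StepConsts} {α₀ α₁ γ₀ : ℝ}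
    {Φ : FieldPair P 0 (MatA N)ˣ (MatA N)} (hsat : SatisfiesI_III (suModel N) FB cB α₀ α₁ γ₀ Φ) (c : PBond P 1)
    (hXb : ∀ b : PBond P 0, (blockOf b.src = c.src ∨ blockOf b.src = c.tgt) → (blockOf b.tgt = c.src ∨ blockOf b.tgt = c.tgt) → b ∈ FB.X.bonds)
    (hXp : ∀ p : Plaq P 0, (blockOf p.src = c.src ∨ blockOf p.src = c.tgt) →
      (blockOf (p.src.shift p.μ) = c.src ∨ blockOf (p.src.shift p.μ) = c.tgt) →
      (blockOf (p.src.shift p.ν) = c.src ∨ blockOf (p.src.shift p.ν) = c.tgt) →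
      (blockOf ((p.src.shift p.μ).shift p.ν) = c.src ∨ blockOf ((p.src.shift p.μ).shift p.ν) = c.tgt) → p ∈ FB.X.plaqs)
    (hξ : 0 ≤ cB.ξ) (hα₀ : 0 ≤ α₀) (hα₁ : 0 ≤ α₁) (hξ₁ : cB.ξ * α₁ ≤ 1 / 4)
    (h3 : ((((P.d + 2) * P.L : ℕ) : ℝ) ^ 2 / 2) * (α₀ * cB.ξ ^ 2) + ((1 + 2 * (2 * (cB.ξ * α₁))) ^ ((P.d + 2) * P.L) - 1) ≤ 1 / 3)
    (hπ : (N : ℝ) * (((((P.d + 2) * P.L : ℕ) : ℝ) ^ 2 / 2) * (α₀ * cB.ξ ^ 2) + ((1 + 2 * (2 * (cB.ξ * α₁))) ^ ((P.d + 2) * P.L) - 1)) < Real.pi) :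
    avgUnits Φ.U c ∈ (suModel N).Gc := by
  classical
  obtain ⟨hUGc, -, U, A', hf, hI, hII, -⟩ := hsat
  -- the two-block predicate and the cut-off fields
  let χ : PBond P 0 → Prop := fun b => (blockOf b.src = c.src ∨ blockOf b.src = c.tgt) ∧ (blockOf b.tgt = c.src ∨ blockOf b.tgt = c.tgt)
  let Uc' : GaugeField P 0 (MatA N)ˣ := fun b => if χ b then Φ.U b else 1
  let U' : GaugeField P 0 (MatA N)ˣ := fun b => if χ b then U b else 1
  let e' : GaugeField P 0 (MatA N)ˣ := fun b => if χ b then expI cB.ξ (A' b) else 1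
  have hagree : ∀ b : PBond P 0, (blockOf b.src = c.src ∨ blockOf b.src = c.tgt) → (blockOf b.tgt = c.src ∨ blockOf b.tgt = c.tgt) →
      Φ.U b = Uc' b := fun b h1 h2 => by simp only [Uc', χ, if_pos (And.intro h1 h2)]
  have hagreeU : ∀ b : PBond P 0, (blockOf b.src = c.src ∨ blockOf b.src = c.tgt) → (blockOf b.tgt = c.src ∨ blockOf b.tgt = c.tgt) →
      U b = U' b := fun b h1 h2 => by simp only [U', χ, if_pos (And.intro h1 h2)]
  -- the factorisation and the letters of the cut-off fields
  have hf' : ∀ b, Uc' b = e' b * U' b := fun b => by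
    by_cases hb : χ b
    · simp only [Uc', U', e', if_pos hb]; exact hf b
    · simp only [Uc', U', e', if_neg hb, one_mul]
  have hUc' : ∀ b, Uc' b ∈ (suModel N).Gc := fun b => by
    by_cases hb : χ b
    · simp only [Uc', if_pos hb]; exact hUGc b (hXb b hb.1 hb.2)
    · simp only [Uc', if_neg hb]; exact (suModel N).Gc.one_mem
  have hU'1 : ∀ b, ‖((U' b : (MatA N)ˣ) : MatA N)‖ ≤ 1 := fun b => by
    by_cases hb : χ b
    · simp only [U', if_pos hb]; exact suModel_norm_le _ (hI.gValued b (hXb b hb.1 hb.2))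
    · simp only [U', if_neg hb, Units.val_one, norm_one]; exact le_rfl
  have hU'2 : ∀ b, ‖(((U' b)⁻¹ : (MatA N)ˣ) : MatA N)‖ ≤ 1 := fun b => by
    by_cases hb : χ b
    · simp only [U', if_pos hb]; exact suModel_norm_le _ ((suModel N).G.inv_mem (hI.gValued b (hXb b hb.1 hb.2)))
    · simp only [U', if_neg hb, inv_one, Units.val_one, norm_one]; exact le_rfl
  have hε : 2 * (cB.ξ * α₁) ≤ 1 / 2 := by linarith
  have he' : ∀ b, ‖((e' b : (MatA N)ˣ) : MatA N) - 1‖ ≤ 2 * (cB.ξ * α₁) := fun b => by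
    by_cases hb : χ b
    · simp only [e', if_pos hb]
      have hA : ‖A' b‖ ≤ α₁ := (hII.norm_lt b (hXb b hb.1 hb.2)).le
      have h1 : cB.ξ * ‖A' b‖ ≤ cB.ξ * α₁ := mul_le_mul_of_nonneg_left hA hξ
      exact (norm_coe_expI_sub_one_le hξ (h1.trans (by linarith))).trans (by linarith)
    · simp only [e', if_neg hb, Units.val_one, sub_self, norm_zero]
      exact mul_nonneg zero_le_two (mul_nonneg hξ hα₁)
  -- the loops of the cut-off factor = the loops of the factor, small by the two-block box Stokes from (1.11)
  have hr : ∀ i : Idx P, ‖((loopVarU U' c i : (MatA N)ˣ) : MatA N) - 1‖ ≤ ((((P.d + 2) * P.L : ℕ) : ℝ) ^ 2 / 2) * (α₀ * cB.ξ ^ 2) := fun i => by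
    have hloop : loopVarU U' c i = loopVarU U c i := (holT_loopWord_congr₂ hj c hagreeU i).symm
    rw [hloop]
    refine norm_loopVarU_sub_one_le_of_plaq_twoBlock hj c (mul_nonneg hα₀ (sq_nonneg _)) (fun b h1 h2 => mem_U1.mpr ⟨?_, ?_⟩)
      (fun p h1 h2 h3 h4 => (hI.plaq_lt p (hXp p h1 h2 h3 h4)).le) i
    · exact suModel_norm_le _ (hI.gValued b (hXb b h1 h2))
    · exact suModel_norm_le _ ((suModel N).G.inv_mem (hI.gValued b (hXb b h1 h2)))
  -- assemble on the cut-off fields, then return to `Φ.𝐔` by two-block locality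
  have hmem := avgUnits_mem_suModel_Gc_of_factors hf' hUc' hU'1 hU'2 hε he' c hr h3 hπ
  have heq : avgUnits Φ.U c = avgUnits Uc' c := emlAvgU_congr₂ hj c hagree
  rw [heq]
  exact hmem

end Region

section Record

variable {F : T4Family} {N k : ℕ} [NeZero N]

/-- ★★★ **THE LETTER `hUGc` FROM RUN B's (i)–(iii), FOR THE TRANSPORT OF RECORD, NO CUBE**: at a run-A bond `b` whose coarse bond `c = bondShift b` has its two-block bonds
and two-block plaquettes inside run B's region, `(TΦOfRecord F N k Φ).U b ∈ SL(N, ℂ)` for every `Φ` satisfying (i)–(iii) of run B (numerics displayed).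
[cite: Balaban1987RG1, before (0.5) p.253, (1.10)-(1.14) p.262] -/
theorem TΦOfRecord_U_mem_suModel_Gc_of_satisfiesI_III_of_plaqs {FB : Frame (F.P (k + 1)) 0 (MatA N)} {cB : StepConsts} {α₀ α₁ γ₀ : ℝ}
    {Φ : FieldPair (F.P (k + 1)) 0 (MatA N)ˣ (MatA N)} (hsat : SatisfiesI_III (suModel N) FB cB α₀ α₁ γ₀ Φ) (b : PBond (F.P k) 0)
    (hXb : ∀ b' : PBond (F.P (k + 1)) 0,
      (blockOf b'.src = (bondShift (sitesPerDir_ladder F (K := k) (j := 0) rfl rfl) b).src ∨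
          blockOf b'.src = (bondShift (sitesPerDir_ladder F (K := k) (j := 0) rfl rfl) b).tgt) →
        (blockOf b'.tgt = (bondShift (sitesPerDir_ladder F (K := k) (j := 0) rfl rfl) b).src ∨
          blockOf b'.tgt = (bondShift (sitesPerDir_ladder F (K := k) (j := 0) rfl rfl) b).tgt) → b' ∈ FB.X.bonds)
    (hXp : ∀ p : Plaq (F.P (k + 1)) 0,
      (blockOf p.src = (bondShift (sitesPerDir_ladder F (K := k) (j := 0) rfl rfl) b).src ∨
          blockOf p.src = (bondShift (sitesPerDir_ladder F (K := k) (j := 0) rfl rfl) b).tgt) →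
        (blockOf (p.src.shift p.μ) = (bondShift (sitesPerDir_ladder F (K := k) (j := 0) rfl rfl) b).src ∨
          blockOf (p.src.shift p.μ) = (bondShift (sitesPerDir_ladder F (K := k) (j := 0) rfl rfl) b).tgt) →
        (blockOf (p.src.shift p.ν) = (bondShift (sitesPerDir_ladder F (K := k) (j := 0) rfl rfl) b).src ∨
          blockOf (p.src.shift p.ν) = (bondShift (sitesPerDir_ladder F (K := k) (j := 0) rfl rfl) b).tgt) →
        (blockOf ((p.src.shift p.μ).shift p.ν) = (bondShift (sitesPerDir_ladder F (K := k) (j := 0) rfl rfl) b).src ∨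
          blockOf ((p.src.shift p.μ).shift p.ν) = (bondShift (sitesPerDir_ladder F (K := k) (j := 0) rfl rfl) b).tgt) → p ∈ FB.X.plaqs)
    (hξ : 0 ≤ cB.ξ) (hα₀ : 0 ≤ α₀) (hα₁ : 0 ≤ α₁) (hξ₁ : cB.ξ * α₁ ≤ 1 / 4)
    (h3 : (((((F.P (k + 1)).d + 2) * (F.P (k + 1)).L : ℕ) : ℝ) ^ 2 / 2) * (α₀ * cB.ξ ^ 2) +
        ((1 + 2 * (2 * (cB.ξ * α₁))) ^ (((F.P (k + 1)).d + 2) * (F.P (k + 1)).L) - 1) ≤ 1 / 3)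
    (hπ : (N : ℝ) * ((((((F.P (k + 1)).d + 2) * (F.P (k + 1)).L : ℕ) : ℝ) ^ 2 / 2) * (α₀ * cB.ξ ^ 2) +
        ((1 + 2 * (2 * (cB.ξ * α₁))) ^ (((F.P (k + 1)).d + 2) * (F.P (k + 1)).L) - 1)) < Real.pi) :
    (TΦOfRecord F N k Φ).U b ∈ (suModel N).Gc := by
  rw [TΦOfRecord_U]
  exact avgUnits_mem_suModel_Gc_of_satisfiesI_III_of_plaqs (by simp only [T4Family.P_m, T4Family.P_K]; omega) hsat _ hXb hXp hξ hα₀ hα₁ hξ₁ h3 hπ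

/-- **A fine plaquette whose four corners have their blocks over `{y, y + e_μ} ⊂ Z` is a plaquette of run B's region over `Z`** (`regionOfSet (bmap ⁻¹' Z)`; the plaquette
twin of this seat's g2 `YMDAG.N18.AvgPotential.twoBlocks_subset_bonds_preimage`). [cite: Balaban1987RG1, (1.11) p.262, (0.24)-(0.25) p.257] -/
theorem twoBlocks_subset_plaqs_preimage (Z : Set (Site (F.P k) 0)) {y : Site (F.P k) 0} {μ : Fin 4}
    (hb : (⟨y, μ⟩ : PBond (F.P k) 0) ∈ (regionOfSet (F.P k) Z).bonds) (p : Plaq (F.P (k + 1)) 0)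
    (h1 : blockOf p.src = siteShift (YMDAG.N18.TwoRunCubes.ladder F k) y ∨ blockOf p.src = (siteShift (YMDAG.N18.TwoRunCubes.ladder F k) y).shift μ)
    (h2 : blockOf (p.src.shift p.μ) = siteShift (YMDAG.N18.TwoRunCubes.ladder F k) y ∨
      blockOf (p.src.shift p.μ) = (siteShift (YMDAG.N18.TwoRunCubes.ladder F k) y).shift μ)
    (h3 : blockOf (p.src.shift p.ν) = siteShift (YMDAG.N18.TwoRunCubes.ladder F k) y ∨
      blockOf (p.src.shift p.ν) = (siteShift (YMDAG.N18.TwoRunCubes.ladder F k) y).shift μ)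
    (h4 : blockOf ((p.src.shift p.μ).shift p.ν) = siteShift (YMDAG.N18.TwoRunCubes.ladder F k) y ∨
      blockOf ((p.src.shift p.μ).shift p.ν) = (siteShift (YMDAG.N18.TwoRunCubes.ladder F k) y).shift μ) :
    p ∈ (regionOfSet (F.P (k + 1)) ((fun x => (siteShift (YMDAG.N18.TwoRunCubes.ladder F k)).symm (blockOf x)) ⁻¹' Z)).plaqs := by
  obtain ⟨hy, hyμ⟩ := hb
  have hyμ' : y.shift μ ∈ Z := hyμ
  have key : ∀ x : Site (F.P (k + 1)) 0,
      (blockOf x = siteShift (YMDAG.N18.TwoRunCubes.ladder F k) y ∨ blockOf x = (siteShift (YMDAG.N18.TwoRunCubes.ladder F k) y).shift μ) →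
        x ∈ (fun x => (siteShift (YMDAG.N18.TwoRunCubes.ladder F k)).symm (blockOf x)) ⁻¹' Z := by
    intro x h
    show (siteShift (YMDAG.N18.TwoRunCubes.ladder F k)).symm (blockOf x) ∈ Z
    rcases h with h | h
    · rw [h, Equiv.symm_apply_apply]; exact hy
    · rw [h, ← siteShift_shift, Equiv.symm_apply_apply]; exact hyμ'
  exact ⟨key _ h1, key _ h2, key _ h3, key _ h4⟩

/-- ★★★★ **THE LETTER `hUGc` OF FILE 7's `hletters` AT EVERY FRAME BOND, FROM RUN B's (i)–(iii) + NUMERICS ONLY.**  Let `Y ∈ 𝐃_j` of run A with sites `domSites Y`, and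
`π(j, Y) = pairOfRecord F M k ⟨j, Y⟩` the paired domain of run B (sites `bmap ⁻¹' domSites Y`, 19c `domSites_pairOfRecord_eq_preimage`).  For EVERY bond `b` of run A's
region over `domSites Y` (both ends in it — interior, (1.12)-cube-face-crossing or boundary bonds alike) and every pair `Φ` with `SatisfiesI_III (suModel N)
(frameI Rz M (j+1) (domSites π(j,Y))) cB α₀ α₁ γ₀ Φ`: `(TΦOfRecord F N k Φ).U b ∈ SL(N, ℂ)`.  At the settings of record `(Sg k).𝓜 = suModel N` by `rfl`, so this is the
`hUGc` conjunct of `YMDAG.N18.TransportOfRecord.admTransport_spaceOfRecord_unit_ofRecord_orbit_of_letters` verbatim (after `show`), under the displayed numerics.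
[cite: Balaban1987RG1, before (0.5) p.253, (0.24)-(0.25) p.257, (1.10)-(1.14) p.262] -/
theorem TΦOfRecord_U_mem_suModel_Gc_of_satisfiesI_III_frameBond (Rz : Node00.Sect2.Residual (F.P (k + 1)) (MatA N)) (M j' : ℕ)
    (Y : (domSys (F.P k) M j').Dom) {cB : StepConsts} {α₀ α₁ γ₀ : ℝ} {Φ : FieldPair (F.P (k + 1)) 0 (MatA N)ˣ (MatA N)}
    (hsat : SatisfiesI_III (suModel N) (frameI Rz M (j' + 1) (domSites (F.P (k + 1)) M (j' + 1) (pairOfRecord F M k ⟨j', Y⟩).2)) cB α₀ α₁ γ₀ Φ)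
    (b : PBond (F.P k) 0) (hb : b ∈ (regionOfSet (F.P k) (domSites (F.P k) M j' Y)).bonds)
    (hξ : 0 ≤ cB.ξ) (hα₀ : 0 ≤ α₀) (hα₁ : 0 ≤ α₁) (hξ₁ : cB.ξ * α₁ ≤ 1 / 4)
    (h3 : (((((F.P (k + 1)).d + 2) * (F.P (k + 1)).L : ℕ) : ℝ) ^ 2 / 2) * (α₀ * cB.ξ ^ 2) +
        ((1 + 2 * (2 * (cB.ξ * α₁))) ^ (((F.P (k + 1)).d + 2) * (F.P (k + 1)).L) - 1) ≤ 1 / 3)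
    (hπ : (N : ℝ) * ((((((F.P (k + 1)).d + 2) * (F.P (k + 1)).L : ℕ) : ℝ) ^ 2 / 2) * (α₀ * cB.ξ ^ 2) +
        ((1 + 2 * (2 * (cB.ξ * α₁))) ^ (((F.P (k + 1)).d + 2) * (F.P (k + 1)).L) - 1)) < Real.pi) :
    (TΦOfRecord F N k Φ).U b ∈ (suModel N).Gc := by
  have hX : (frameI Rz M (j' + 1) (domSites (F.P (k + 1)) M (j' + 1) (pairOfRecord F M k ⟨j', Y⟩).2)).X =
      regionOfSet (F.P (k + 1)) ((fun x => (siteShift (YMDAG.N18.TwoRunCubes.ladder F k)).symm (blockOf x)) ⁻¹' domSites (F.P k) M j' Y) := by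
    show regionOfSet (F.P (k + 1)) (domSites (F.P (k + 1)) M (j' + 1) (pairOfRecord F M k ⟨j', Y⟩).2) = _
    rw [YMDAG.N18.TwoRunCubes.domSites_pairOfRecord_eq_preimage]
  obtain ⟨y, μ⟩ := b
  refine TΦOfRecord_U_mem_suModel_Gc_of_satisfiesI_III_of_plaqs hsat ⟨y, μ⟩ (fun b' h1 h2 => ?_) (fun p h1 h2 h3 h4 => ?_) hξ hα₀ hα₁ hξ₁ h3 hπ
  · rw [hX]
    exact YMDAG.N18.AvgPotential.twoBlocks_subset_bonds_preimage F k _ hb b' h1 h2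
  · rw [hX]
    exact twoBlocks_subset_plaqs_preimage _ hb p h1 h2 h3 h4

end Record

end YMDAG.N18.TransportOfRecord

end
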